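import Mathlib
import HarnessLib

/-!
# `NoHeavyLowerTail` (crux stmt-CriticalPhenomena-4575), antithetic vdBHK programme: KERNEL CERTIFICATE that the colouring poset of the
# CROWN 4-CYCLE C₈ is NOT antipodal Kleitman (FINDING-OBSTRUCTION-g46.md §5c — the instance refuting the 'triangle' criterion)

Support file (seat `prim-ineq-gen-7` gen 46; `--supports stmt-CriticalPhenomena-4575`).  No `sorry`, no definitions; one `decide` certificate.

THE OBJECT.  `C₈` is the height-one poset on `{0,…,7}` with minimal elements `0,1,2,3` and maximal elements `4 > 0,1`, `5 > 1,2`, `6 > 2,3`, `7 > 3,0`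
(the 7-fence closed up to a cycle; principal down-sets as bit masks `↓0..↓7 = 1, 2, 4, 8, 19, 38, 76, 137`).  Its atom hypergraph is a 4-cycle: it
contains NO induced 3-crown on atoms, so THEOREM CO (…AntitheticCrownUniversal) does not apply, and the 'triangle criterion' (CONJECTURE C of the memo)
predicted it to be antipodal Kleitman.  It is not: with colourings coded as bit masks `s < 256` (bit `e` = element `e` red), red interior
`κ(s) = {e : ↓e ⊆ s}`, the colouring order `s ≼ t :⟺ κ t ⊆ κ s ∧ κ s̄ ⊆ κ t̄ ∧ s ∩ t̄ ⊆ κ s ∩ κ t̄` (`s̄ = 255 - s`) and `ι s = s̄`, the up-sets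
`A` (128 colourings, a half) and `B` (125 colourings) below satisfy `#(A ∩ B) = 62 < 63 = #(A ∩ ιB)`.  (kit46d j241840: roundingsat 101 s / kissat 852 s on
the orbit-identity PB model, witness re-verified in-seat.)  Consequence: the obstruction to antipodal Kleitman is (at least) every β-CYCLE of the atom
hypergraph, not only triangles — CONJECTURE Cβ of the memo; C₈ is the unique β-cyclic crown-free poset among the 16,999 posets with 8 elements.
-/

namespace Summit.CriticalPhenomena.PercolationContinuityZ3.Theorems

namespace AntitheticCrownCycle

/-- **The colouring poset of the crown 4-cycle `C₈` is not antipodal Kleitman** (kernel-checked certificate). With `κ` the red-interior map of `C₈`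
(`↓`-masks `1, 2, 4, 8, 19, 38, 76, 137`) and `le` the colouring order on bit masks `< 256`, there are two `le`-up-sets `A, B ⊆ Fin 256` with
`#(A ∩ B) < #(A ∩ ιB)`, `ι s = 255 - s`. [this work; FINDING-OBSTRUCTION-g46 §5c] -/
theorem crownCycle_not_antipodalKleitman
    (κ : ℕ → ℕ)
    (hκ : κ = fun s =>
      (if s &&& 1 = 1 then 1 else 0) + (if s &&& 2 = 2 then 2 else 0) + (if s &&& 4 = 4 then 4 else 0) + (if s &&& 8 = 8 then 8 else 0) +
      (if s &&& 19 = 19 then 16 else 0) + (if s &&& 38 = 38 then 32 else 0) + (if s &&& 76 = 76 then 64 else 0) + (if s &&& 137 = 137 then 128 else 0))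
    (le : ℕ → ℕ → Prop)
    (hle : le = fun s t =>
      κ t &&& κ s = κ t ∧ κ (255 - s) &&& κ (255 - t) = κ (255 - s) ∧
      (s &&& (255 - t)) &&& (κ s &&& κ (255 - t)) = s &&& (255 - t)) :
    ∃ A B : Finset (Fin 256),
      (∀ s ∈ A, ∀ t : Fin 256, le s.val t.val → t ∈ A) ∧
      (∀ s ∈ B, ∀ t : Fin 256, le s.val t.val → t ∈ B) ∧
      (A ∩ B).card < (A ∩ B.image (fun s : Fin 256 => (⟨255 - s.val, by omega⟩ : Fin 256))).card := by
  subst hκ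
  subst hle
  refine ⟨Finset.univ.filter (fun s : Fin 256 =>
      Nat.testBit 25087847956205061998530832546907386078039161931722298772621678886359787573523 s.val = true),
    Finset.univ.filter (fun s : Fin 256 =>
      Nat.testBit 38897174338837245228885981094123614171729102466721277142179735833735926710357 s.val = true), ?_, ?_, ?_⟩
  · decide +kernel
  · decide +kernel
  · decide +kernel

end AntitheticCrownCycle

end Summit.CriticalPhenomena.PercolationContinuityZ3.Theorems
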